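import Mathlib
import Literature.NumberTheory.Transcendental.KZRayDilog
import Literature.NumberTheory.Transcendental.KZIdealTetrahedron
import Literature.NumberTheory.Transcendental.KZCalculusProofs
import Literature.NumberTheory.Transcendental.BlochWignerIdealTetrahedronVolume
import Literature.NumberTheory.Transcendental.SemialgebraicMapsProofs
import Literature.NumberTheory.Transcendental.KZSemialgebraicComplex

/-!
# `OffTetraSectorKernel`, line `flat-shadow`: scaling the `C`-cell onto the `G`-cell (stub `stub_cellScale`)

Stub `stub_cellScale` of the crux `OffTetraSectorKernel` (stmt-KontsevichZagierPeriods-10557, route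
HyperbolicBloch): a station of the Milnor bridge, Kontsevich–Zagier's rule (2) for the SCALING of
the `C`-cell onto the `G`-cell (log-cell algebra: the form `dv/v` is dilation invariant).
Notation: `z = a + ib` algebraic, `b > 0`, `N = |z|²`, `c = N − 2a` (so `1 + c = (1 − a)² + b² > 0`
and `1 + cs > 0` on `[0, 1]`), `Q(s) = (1 − sa)² + (sb)² > 0`, `g(s) = s(1 + cs)/(1 − s)`;
coordinates `w 0 = s`, `w 1 = v`. The `C`-cell is
`C = [{0 < s < 1, v strictly between (1 − s)/s and 1 + cs}, sgn(1 + cs − v)·b/(2 Q(s) v)]`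
(sheets `{1 − s < vs, v < 1 + cs}` and `{1 + cs < v, vs < 1 − s}`), the `G`-cell is
`G = [{0 < s < 1, v strictly between 1 and g(s)}, sgn(v − 1)·b/(2 Q(s) v)]` (sheets written
denominator-free: `{1 < v, v(1 − s) < s(1 + cs)}` and `{s(1 + cs) < v(1 − s), v < 1}`).
The map `Φ(s, v) = (s, v s/(1 − s))` is `ℚ`-semialgebraic (coordinates are quotients of rational
polynomials, denominator `1 − s ≠ 0`), injective on `{0 < s < 1}` (inverse `v = v′(1 − s)/s`), has
derivative `[[1, 0], [v/(1 − s)², s/(1 − s)]]` of determinant `s/(1 − s) > 0`, and maps the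
`C`-domain ONTO the `G`-domain (`(1 − s)/s ↦ 1`, `1 + cs ↦ g(s)`; the sheet `1 − s < vs` goes to
`1 < v′`, the sheet `vs < 1 − s` to `v′ < 1`). Since `v < 1 + cs ⟺ v′ < g(s)` and on the
`G`-domain `v′ < g(s) ⟺ 1 < v′`, the Jacobian identity
`sgn(1 + cs − v)·b/(2 Q v) = [sgn(v′ − 1)·b/(2 Q v′)]·s/(1 − s)` (`v′ = v s/(1 − s)`) makes
`[C] − [G]` ONE element of `KZ.changeOfVariablesRel`, and a representation on the `G`-domain with
the `G`-integrand EXISTS: `G`-domain `= Φ(C-domain)` is `ℚ`-semialgebraic by Tarski–Seidenberg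
(`IsSemialgebraicMapOn.isSemialgebraic_image_holds`), the integrand is Zagier's ray sign
`sgn(v − 1)` (`KZ.isSemialgebraicFunOn_rayDilogSign`) times a quotient with real-algebraic
coefficients and denominator `2 Q v > 0`, and it is integrable on `Φ(C-domain)` by Mathlib's
change-of-variables criterion `MeasureTheory.integrableOn_image_iff_integrableOn_abs_det_fderiv_smul`
(the pulled-back density IS the `C`-integrand).

References: M. Kontsevich, D. Zagier, *Periods* (2001), §1.2 rule (2); D. Zagier, *The dilogarithm
function* (2007), Ch. I §3; J. Milnor, *Hyperbolic geometry: the first 150 years* (1982);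
J. Bochnak, M. Coste, M.-F. Roy, *Real Algebraic Geometry* (1998), §2.2 (Prop. 2.2.6, 2.2.7).
-/

noncomputable section

open Set MeasureTheory MvPolynomial
open Literature.NumberTheory.Transcendental Literature.ModelTheory.ExponentialFields

namespace Summit.KontsevichZagierPeriods.HyperbolicBloch.OffTetraSectorKernel

variable {z : ℂ}

/-! ## Algebra of the scaling -/

/-- The coordinates of the scaling `Φ(s, v) = (s, v s/(1 − s))`. [folklore] -/
theorem cellScale_apply (Φ : (Fin 2 → ℝ) → (Fin 2 → ℝ))
    (hΦ : ∀ w, Φ w = ![w 0, w 1 * w 0 / (1 - w 0)]) (w : Fin 2 → ℝ) :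
    Φ w 0 = w 0 ∧ Φ w 1 = w 1 * w 0 / (1 - w 0) := by
  rw [hΦ]
  exact ⟨rfl, rfl⟩

/-- Points of the `C`-domain have positive second coordinate: on the sheet `1 − s < vs` because
`s > 0`, `1 − s > 0`; on the sheet `1 + cs < v` because `1 + cs > 0` for `0 ≤ s ≤ 1`
(`c = |z|² − 2a = a² + b² − 2a`, `IdealTetrahedronVolume.one_add_c_mul_pos`). [folklore] -/
theorem cellScale_pos_of_mem (hz : 0 < z.im) {w : Fin 2 → ℝ}
    (hw : w ∈ {w : Fin 2 → ℝ | 0 < w 0 ∧ w 0 < 1 ∧ ((1 - w 0 < w 1 * w 0 ∧ w 1 < 1 + (Complex.normSq z - 2 * z.re) * w 0) ∨ (1 + (Complex.normSq z - 2 * z.re) * w 0 < w 1 ∧ w 1 * w 0 < 1 - w 0))}) :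
    0 < w 1 := by
  obtain ⟨h0, h1, ⟨hL, -⟩ | ⟨hc, -⟩⟩ := hw
  · exact pos_of_mul_pos_left ((sub_pos.mpr h1).trans hL) h0.le
  · have h := IdealTetrahedronVolume.one_add_c_mul_pos z.re hz h0.le h1.le
    rw [Complex.normSq_apply] at hc
    nlinarith [h, hc]

/-- **The image of the `C`-domain under the scaling is the `G`-domain.** For fixed `s ∈ (0, 1)`,
`v ↦ v s/(1 − s)` is an increasing linear bijection with inverse `v′ ↦ v′(1 − s)/s`, sending
`(1 − s)/s ↦ 1` and `1 + cs ↦ g(s) = s(1 + cs)/(1 − s)`; both cells are written denominator-free.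
[cite: Zagier2007Dilogarithm, Ch. I §3] -/
theorem cellScale_image (Φ : (Fin 2 → ℝ) → (Fin 2 → ℝ))
    (hΦ : ∀ w, Φ w = ![w 0, w 1 * w 0 / (1 - w 0)]) (c : ℝ) :
    Φ '' {w | 0 < w 0 ∧ w 0 < 1 ∧ ((1 - w 0 < w 1 * w 0 ∧ w 1 < 1 + c * w 0) ∨ (1 + c * w 0 < w 1 ∧ w 1 * w 0 < 1 - w 0))} = {w | 0 < w 0 ∧ w 0 < 1 ∧ ((1 < w 1 ∧ w 1 * (1 - w 0) < w 0 * (1 + c * w 0)) ∨ (w 0 * (1 + c * w 0) < w 1 * (1 - w 0) ∧ w 1 < 1))} := by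
  ext w
  constructor
  · -- `Φ` maps the `C`-domain into the `G`-domain
    rintro ⟨x, ⟨h0, h1, hsh⟩, rfl⟩
    obtain ⟨e0, e1⟩ := cellScale_apply Φ hΦ x
    simp only [mem_setOf_eq, e0, e1]
    have h1' : (0 : ℝ) < 1 - x 0 := by linarith
    have hvs : x 1 * x 0 / (1 - x 0) * (1 - x 0) = x 1 * x 0 := div_mul_cancel₀ _ h1'.ne'
    refine ⟨h0, h1, ?_⟩
    rcases hsh with ⟨hL, hU⟩ | ⟨hU, hL⟩
    · refine Or.inl ⟨(one_lt_div h1').mpr hL, ?_⟩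
      rw [hvs]
      linarith [mul_lt_mul_of_pos_left hU h0]
    · refine Or.inr ⟨?_, (div_lt_one h1').mpr hL⟩
      rw [hvs]
      linarith [mul_lt_mul_of_pos_left hU h0]
  · -- the `G`-domain is covered: `v = v′(1 − s)/s`
    rintro ⟨h0, h1, hsh⟩
    have h1' : (0 : ℝ) < 1 - w 0 := by linarith
    refine ⟨![w 0, w 1 * (1 - w 0) / w 0], ?_, ?_⟩
    · simp only [mem_setOf_eq, Matrix.cons_val_zero, Matrix.cons_val_one, Matrix.cons_val_fin_one]
      have hus : w 1 * (1 - w 0) / w 0 * w 0 = w 1 * (1 - w 0) := div_mul_cancel₀ _ h0.ne'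
      refine ⟨h0, h1, ?_⟩
      rcases hsh with ⟨hv1, hg⟩ | ⟨hg, hv1⟩
      · refine Or.inl ⟨?_, (div_lt_iff₀ h0).mpr (by linarith [hg])⟩
        rw [hus]
        exact (lt_mul_iff_one_lt_left h1').mpr hv1
      · refine Or.inr ⟨(lt_div_iff₀ h0).mpr (by linarith [hg]), ?_⟩
        rw [hus]
        exact (mul_lt_iff_lt_one_left h1').mpr hv1
    · rw [hΦ]
      funext i
      fin_cases i
      · simp
      · simp only [Fin.mk_one, Fin.isValue, Matrix.cons_val_one, Matrix.cons_val_zero,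
          Matrix.cons_val_fin_one]
        field_simp

/-- The scaling is injective on every `σ ⊆ {0 < s < 1}`: the first coordinate is kept and, for
fixed `s`, the second is linear in `v` with slope `s/(1 − s) ≠ 0`. [folklore] -/
theorem cellScale_injOn (Φ : (Fin 2 → ℝ) → (Fin 2 → ℝ))
    (hΦ : ∀ w, Φ w = ![w 0, w 1 * w 0 / (1 - w 0)]) {σ : Set (Fin 2 → ℝ)}
    (hσ : σ ⊆ {w | 0 < w 0 ∧ w 0 < 1}) : InjOn Φ σ := by
  intro w hw w' _ h
  obtain ⟨h0, h1⟩ := hσ hw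
  obtain ⟨e0, e1⟩ := cellScale_apply Φ hΦ w
  obtain ⟨e0', e1'⟩ := cellScale_apply Φ hΦ w'
  have hs : w 0 = w' 0 := by rw [← e0, ← e0', h]
  have hv : Φ w 1 = Φ w' 1 := by rw [h]
  rw [e1, e1', ← hs, mul_div_assoc, mul_div_assoc] at hv
  have hk : w 0 / (1 - w 0) ≠ 0 := (div_pos h0 (by linarith)).ne'
  have hu : w 1 = w' 1 := mul_right_cancel₀ hk hv
  funext i
  fin_cases i
  exacts [hs, hu]

/-! ## Semialgebraicity -/

/-- The scaling is a `ℚ`-semialgebraic map on every `ℚ`-semialgebraic `σ ⊆ {s < 1}`: its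
coordinates are the rational polynomial `X₀` and the quotient `X₁ X₀ / (1 − X₀)` whose denominator
does not vanish on `σ`. [cite: BochnakCosteRoy1998, §2.2] -/
theorem cellScale_isSemialgebraicMapOn (Φ : (Fin 2 → ℝ) → (Fin 2 → ℝ))
    (hΦ : ∀ w, Φ w = ![w 0, w 1 * w 0 / (1 - w 0)]) {σ : Set (Fin 2 → ℝ)}
    (hσ : IsSemialgebraic ℚ σ) (hlt : σ ⊆ {w | w 0 < 1}) : IsSemialgebraicMapOn ℚ σ Φ := by
  have hq0 : ∀ w ∈ σ, aeval w (1 - X 0 : MvPolynomial (Fin 2) ℚ) ≠ 0 := fun w hw => by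
    have h1 : w 0 < 1 := hlt hw
    simpa [sub_eq_zero] using h1.ne'
  refine IsSemialgebraicMapOn.of_forall hσ fun j => ?_
  fin_cases j
  · exact (isSemialgebraicFunOn_aeval hσ (X 0)).congr fun w _ => by
      simp [(cellScale_apply Φ hΦ w).1]
  · exact (isSemialgebraicFunOn_aeval_div_aeval hσ (X 1 * X 0) (1 - X 0) hq0).congr
      fun w _ => by simp [(cellScale_apply Φ hΦ w).2]

/-- The `G`-density `sgn(v − 1)·b/(2 Q(s) v)` is a `ℚ`-semialgebraic function on every
`ℚ`-semialgebraic `σ ⊆ {v > 0}` for algebraic `Re z`, `Im z ≠ 0`: Zagier's ray sign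
(`KZ.isSemialgebraicFunOn_rayDilogSign`) times a quotient of polynomials with real-algebraic
coefficients (`isSemialgebraicFunOn_const_of_isAlgebraic`) whose denominator `2 Q(s) v` does not
vanish on `σ`. [cite: KontsevichZagier2001, §1.1] -/
theorem cellScale_isSemialgebraicFunOn (hre : IsAlgebraic ℚ z.re) (him : IsAlgebraic ℚ z.im)
    (hz : 0 < z.im) {σ : Set (Fin 2 → ℝ)} (hσ : IsSemialgebraic ℚ σ) (hpos : ∀ w ∈ σ, 0 < w 1) :
    IsSemialgebraicFunOn ℚ σ (fun w => (if 1 < w 1 then (1 : ℝ) else -1) * z.im /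
      (2 * ((1 - w 0 * z.re) ^ 2 + (w 0 * z.im) ^ 2) * w 1)) := by
  have s0 : IsSemialgebraicFunOn ℚ σ (fun w => w 0) :=
    (isSemialgebraicFunOn_aeval hσ (X 0)).congr fun w _ => by simp
  have s1 : IsSemialgebraicFunOn ℚ σ (fun w => w 1) :=
    (isSemialgebraicFunOn_aeval hσ (X 1)).congr fun w _ => by simp
  have sone : IsSemialgebraicFunOn ℚ σ (fun _ => (1 : ℝ)) := by
    simpa using isSemialgebraicFunOn_natCast (k := ℚ) (R := ℝ) hσ 1
  have stwo : IsSemialgebraicFunOn ℚ σ (fun _ => (2 : ℝ)) := by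
    simpa using isSemialgebraicFunOn_natCast (k := ℚ) (R := ℝ) hσ 2
  have sre : IsSemialgebraicFunOn ℚ σ (fun _ => z.re) :=
    isSemialgebraicFunOn_const_of_isAlgebraic hσ hre
  have sim : IsSemialgebraicFunOn ℚ σ (fun _ => z.im) :=
    isSemialgebraicFunOn_const_of_isAlgebraic hσ him
  have sQa := IsSemialgebraicFunOn.sub_holds sone (IsSemialgebraicFunOn.mul_holds s0 sre)
  have sQb := IsSemialgebraicFunOn.mul_holds s0 sim
  have sden : IsSemialgebraicFunOn ℚ σ
      (fun w => 2 * ((1 - w 0 * z.re) ^ 2 + (w 0 * z.im) ^ 2) * w 1) := by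
    refine (IsSemialgebraicFunOn.mul_holds (IsSemialgebraicFunOn.mul_holds stwo
      (IsSemialgebraicFunOn.add_holds (IsSemialgebraicFunOn.mul_holds sQa sQa)
        (IsSemialgebraicFunOn.mul_holds sQb sQb))) s1).congr fun w _ => ?_
    simp only [Pi.mul_apply, Pi.add_apply, Pi.sub_apply]
    ring
  have hsign := KZ.isSemialgebraicFunOn_rayDilogSign.mono (subset_univ σ) hσ
  have h := (IsSemialgebraicFunOn.mul_holds hsign sim).div sden fun w hw =>
    (mul_pos (mul_pos two_pos (KZ.rayDilog_den_pos hz.ne' z.re (w 0))) (hpos w hw)).ne'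
  exact h.congr fun _ _ => rfl

/-! ## The derivative -/

/-- **The derivative of the scaling and its determinant.** At a point with `s ≠ 1`, `Φ` has the
Fréchet derivative of matrix `[[1, 0], [v/(1 − s)², s/(1 − s)]]`, of determinant `s/(1 − s)`.
[folklore] -/
theorem cellScale_hasFDerivAt_det (Φ : (Fin 2 → ℝ) → (Fin 2 → ℝ))
    (hΦ : ∀ w, Φ w = ![w 0, w 1 * w 0 / (1 - w 0)]) {x : Fin 2 → ℝ} (hx : 1 - x 0 ≠ 0) :
    ∃ L : (Fin 2 → ℝ) →L[ℝ] (Fin 2 → ℝ), HasFDerivAt Φ L x ∧ L.det = x 0 / (1 - x 0) := by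
  set M : Matrix (Fin 2) (Fin 2) ℝ := !![1, 0; x 1 / (1 - x 0) ^ 2, x 0 / (1 - x 0)] with hM
  refine ⟨LinearMap.toContinuousLinearMap (Matrix.toLin' M), ?_, ?_⟩
  · -- derivative, componentwise
    have e0 : HasFDerivAt (fun y : Fin 2 → ℝ => y 0) (ContinuousLinearMap.proj 0) x :=
      hasFDerivAt_apply (𝕜 := ℝ) 0 x
    have e1 : HasFDerivAt (fun y : Fin 2 → ℝ => y 1) (ContinuousLinearMap.proj 1) x :=
      hasFDerivAt_apply (𝕜 := ℝ) 1 x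
    have h0 : HasFDerivAt (fun y => Φ y 0)
        ((ContinuousLinearMap.proj 0).comp (LinearMap.toContinuousLinearMap (Matrix.toLin' M)))
        x := by
      have hf : (fun y => Φ y 0) = fun y : Fin 2 → ℝ => y 0 := by
        funext y
        exact (cellScale_apply Φ hΦ y).1
      rw [hf]
      refine e0.congr_fderiv (ContinuousLinearMap.ext fun u => ?_)
      simp [hM, Matrix.toLin'_apply, dotProduct, Fin.sum_univ_two]
    have h1 : HasFDerivAt (fun y => Φ y 1)
        ((ContinuousLinearMap.proj 1).comp (LinearMap.toContinuousLinearMap (Matrix.toLin' M)))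
        x := by
      have hf : (fun y => Φ y 1) = fun y : Fin 2 → ℝ =>
          y 1 * y 0 * ((fun t : ℝ => t⁻¹) ∘ fun y : Fin 2 → ℝ => 1 - y 0) y := by
        funext y
        rw [(cellScale_apply Φ hΦ y).2, div_eq_mul_inv]
        rfl
      rw [hf]
      have hinv := (hasDerivAt_inv hx).comp_hasFDerivAt x (e0.const_sub 1)
      have hcomp := (e1.fun_mul e0).fun_mul hinv
      refine hcomp.congr_fderiv (ContinuousLinearMap.ext fun u => ?_)
      simp [hM, Matrix.toLin'_apply, dotProduct, Fin.sum_univ_two]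
      field_simp
      ring
    refine hasFDerivAt_pi'' fun i => ?_
    fin_cases i
    exacts [h0, h1]
  · -- determinant
    rw [LinearMap.det_toContinuousLinearMap, LinearMap.det_toLin', Matrix.det_fin_two]
    simp [hM]

/-- **Scaling move data on the `C`-cell**: a derivative `Φ'` of `Φ` at every point of the
`C`-domain together with the Jacobian identity
`sgn(1 + cs − v)·b/(2 Q(s) v) = sgn(v′ − 1)·b/(2 Q(s) v′) · |det Φ'|` at `v′ = v s/(1 − s)`,
`|det Φ'| = s/(1 − s)` (on the sheet `1 − s < vs, v < 1 + cs` both signs are `+1`, on the sheet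
`1 + cs < v, vs < 1 − s` both are `−1`; `v > 0` on the domain).
[cite: KontsevichZagier2001, §1.2 rule (2)] -/
theorem cellScale_moveData (Φ : (Fin 2 → ℝ) → (Fin 2 → ℝ))
    (hΦ : ∀ w, Φ w = ![w 0, w 1 * w 0 / (1 - w 0)]) (hz : 0 < z.im) :
    ∃ Φ' : (Fin 2 → ℝ) → ((Fin 2 → ℝ) →L[ℝ] (Fin 2 → ℝ)), ∀ x ∈ {w : Fin 2 → ℝ | 0 < w 0 ∧ w 0 < 1 ∧ ((1 - w 0 < w 1 * w 0 ∧ w 1 < 1 + (Complex.normSq z - 2 * z.re) * w 0) ∨ (1 + (Complex.normSq z - 2 * z.re) * w 0 < w 1 ∧ w 1 * w 0 < 1 - w 0))},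
      HasFDerivAt Φ (Φ' x) x ∧
      (if x 1 < 1 + (Complex.normSq z - 2 * z.re) * x 0 then (1 : ℝ) else -1) * z.im /
          (2 * ((1 - x 0 * z.re) ^ 2 + (x 0 * z.im) ^ 2) * x 1) =
        (if 1 < Φ x 1 then (1 : ℝ) else -1) * z.im /
          (2 * ((1 - Φ x 0 * z.re) ^ 2 + (Φ x 0 * z.im) ^ 2) * Φ x 1) * |(Φ' x).det| := by
  have hex : ∀ x : Fin 2 → ℝ, ∃ L : (Fin 2 → ℝ) →L[ℝ] (Fin 2 → ℝ),
      1 - x 0 ≠ 0 → HasFDerivAt Φ L x ∧ L.det = x 0 / (1 - x 0) := by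
    intro x
    by_cases hx : 1 - x 0 = 0
    · exact ⟨0, fun h => (h hx).elim⟩
    · obtain ⟨L, hL, hdet⟩ := cellScale_hasFDerivAt_det Φ hΦ hx
      exact ⟨L, fun _ => ⟨hL, hdet⟩⟩
  choose Φ' hΦ' using hex
  refine ⟨Φ', fun x hx => ?_⟩
  have h0 : 0 < x 0 := hx.1
  have h1' : (0 : ℝ) < 1 - x 0 := by linarith [hx.2.1]
  have hu : 0 < x 1 := cellScale_pos_of_mem hz hx
  have hQ : 0 < (1 - x 0 * z.re) ^ 2 + (x 0 * z.im) ^ 2 := KZ.rayDilog_den_pos hz.ne' z.re (x 0)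
  obtain ⟨hL, hdet⟩ := hΦ' x h1'.ne'
  refine ⟨hL, ?_⟩
  obtain ⟨e0, e1⟩ := cellScale_apply Φ hΦ x
  have hiff : 1 < x 1 * x 0 / (1 - x 0) ↔ 1 - x 0 < x 1 * x 0 := one_lt_div h1'
  have h0' : x 0 ≠ 0 := h0.ne'
  have h1'' : 1 - x 0 ≠ 0 := h1'.ne'
  have hu' : x 1 ≠ 0 := hu.ne'
  have hQ' : (1 - x 0 * z.re) ^ 2 + (x 0 * z.im) ^ 2 ≠ 0 := hQ.ne'
  rw [hdet, e0, e1, abs_of_pos (div_pos h0 h1')]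
  rcases hx.2.2 with ⟨hL1, hU1⟩ | ⟨hU1, hL1⟩
  · -- the sheet `1 − s < vs, v < 1 + cs`: both signs are `+1`
    rw [if_pos hU1, if_pos (hiff.mpr hL1)]
    field_simp
  · -- the sheet `1 + cs < v, vs < 1 − s`: both signs are `−1`
    rw [if_neg (not_lt.mpr hU1.le), if_neg fun h => lt_asymm hL1 (hiff.mp h)]
    field_simp

/-! ## The stub -/

/-- **STUB `stub_cellScale`** (Kontsevich–Zagier's rule (2) for the scaling
`Φ(s, v) = (s, v s/(1 − s))` of the `C`-cell onto the `G`-cell). For algebraic `z` with `Im z > 0`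
and every representation `C = [C-domain, sgn(1 + cs − v)·b/(2 Q(s) v)]`: a representation
`G = [G-domain, sgn(v − 1)·b/(2 Q(s) v)]` EXISTS (semialgebraic image by Tarski–Seidenberg; Zagier's
ray sign times a quotient with real-algebraic coefficients and denominator `2 Q v > 0`; integrable
by the change-of-variables criterion, the pulled-back density being the `C`-integrand), and EVERY
such representation `G` is KZ-equivalent to `C` by the single move `[C] − [G] ∈ changeOfVariablesRel`
(`Φ` semialgebraic, injective on `{0 < s < 1}`, derivative `[[1, 0], [v/(1 − s)², s/(1 − s)]]`,
image the `G`-domain, `C`-integrand `= G.integrand ∘ Φ · |det DΦ|`).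
[cite: KontsevichZagier2001, §1.2 rule (2)] -/
theorem stub_cellScale : ∀ z : ℂ, IsAlgebraic ℚ z → 0 < z.im → ∀ C : Literature.NumberTheory.Transcendental.KZ.IntegralRep 2, C.domain = {w | 0 < w 0 ∧ w 0 < 1 ∧ ((1 - w 0 < w 1 * w 0 ∧ w 1 < 1 + (Complex.normSq z - 2 * z.re) * w 0) ∨ (1 + (Complex.normSq z - 2 * z.re) * w 0 < w 1 ∧ w 1 * w 0 < 1 - w 0))} → Set.EqOn C.integrand (fun w => (if w 1 < 1 + (Complex.normSq z - 2 * z.re) * w 0 then (1 : ℝ) else -1) * z.im / (2 * ((1 - w 0 * z.re) ^ 2 + (w 0 * z.im) ^ 2) * w 1)) C.domain → (∃ G : Literature.NumberTheory.Transcendental.KZ.IntegralRep 2, G.domain = {w | 0 < w 0 ∧ w 0 < 1 ∧ ((1 < w 1 ∧ w 1 * (1 - w 0) < w 0 * (1 + (Complex.normSq z - 2 * z.re) * w 0)) ∨ (w 0 * (1 + (Complex.normSq z - 2 * z.re) * w 0) < w 1 * (1 - w 0) ∧ w 1 < 1))} ∧ Set.EqOn G.integrand (fun w => (if 1 < w 1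 then (1 : ℝ) else -1) * z.im / (2 * ((1 - w 0 * z.re) ^ 2 + (w 0 * z.im) ^ 2) * w 1)) G.domain) ∧ (∀ G : Literature.NumberTheory.Transcendental.KZ.IntegralRep 2, G.domain = {w | 0 < w 0 ∧ w 0 < 1 ∧ ((1 < w 1 ∧ w 1 * (1 - w 0) < w 0 * (1 + (Complex.normSq z - 2 * z.re) * w 0)) ∨ (w 0 * (1 + (Complex.normSq z - 2 * z.re) * w 0) < w 1 * (1 - w 0) ∧ w 1 < 1))} → Set.EqOn G.integrand (fun w => (if 1 < w 1 then (1 : ℝ) else -1) * z.im / (2 * ((1 - w 0 * z.re) ^ 2 + (w 0 * z.im) ^ 2) * w 1)) G.domain → Literature.NumberTheory.Transcendental.KZ.Equivalent C G) := by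
  intro z hz him C hC hCi
  obtain ⟨hre, him'⟩ := isAlgebraic_re_im hz
  -- the move `Φ(s, v) = (s, v s/(1 − s))`
  obtain ⟨Φ, hΦ⟩ : ∃ Φ : (Fin 2 → ℝ) → (Fin 2 → ℝ), ∀ w, Φ w = ![w 0, w 1 * w 0 / (1 - w 0)] :=
    ⟨_, fun _ => rfl⟩
  -- the `C`-domain lies in the strip `0 < s < 1`
  have hsub : C.domain ⊆ {w | 0 < w 0 ∧ w 0 < 1} := fun w hw => by
    rw [hC] at hw
    exact ⟨hw.1, hw.2.1⟩
  -- the image is the `G`-domain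
  have himage : Φ '' C.domain = {w | 0 < w 0 ∧ w 0 < 1 ∧ ((1 < w 1 ∧ w 1 * (1 - w 0) < w 0 * (1 + (Complex.normSq z - 2 * z.re) * w 0)) ∨ (w 0 * (1 + (Complex.normSq z - 2 * z.re) * w 0) < w 1 * (1 - w 0) ∧ w 1 < 1))} := by
    rw [hC]
    exact cellScale_image Φ hΦ (Complex.normSq z - 2 * z.re)
  -- the four data of the move
  have hΦsa : IsSemialgebraicMapOn ℚ C.domain Φ :=
    cellScale_isSemialgebraicMapOn Φ hΦ C.isSemialgebraic_domain fun w hw => (hsub hw).2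
  have hinj : InjOn Φ C.domain := cellScale_injOn Φ hΦ hsub
  obtain ⟨Φ', hΦ'⟩ := cellScale_moveData Φ hΦ him
  have hderiv : ∀ x ∈ C.domain, HasFDerivWithinAt Φ (Φ' x) C.domain x := by
    intro x hx
    have hx' := hx
    rw [hC] at hx'
    exact (hΦ' x hx').1.hasFDerivWithinAt
  have hjac : ∀ x ∈ C.domain, C.integrand x =
      (if 1 < Φ x 1 then (1 : ℝ) else -1) * z.im /
        (2 * ((1 - Φ x 0 * z.re) ^ 2 + (Φ x 0 * z.im) ^ 2) * Φ x 1) * |(Φ' x).det| := by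
    intro x hx
    have hx' := hx
    rw [hC] at hx'
    rw [hCi hx]
    exact (hΦ' x hx').2
  have hmeas : MeasurableSet C.domain := KZ.IntegralRep.measurableSet_domain_holds C
  -- EXISTENCE of `[G-domain, sgn(v − 1)·b/(2 Q v)]`: semialgebraic image, glued quotient,
  -- change of variables
  have hT : IsSemialgebraic ℚ (Φ '' C.domain) :=
    IsSemialgebraicMapOn.isSemialgebraic_image_holds hΦsa subset_rfl C.isSemialgebraic_domain
  have hpos : ∀ w ∈ Φ '' C.domain, 0 < w 1 := by
    rintro _ ⟨x, hx, rfl⟩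
    have hx' := hx
    rw [hC] at hx'
    rw [(cellScale_apply Φ hΦ x).2]
    exact div_pos (mul_pos (cellScale_pos_of_mem him hx') hx'.1) (by linarith [hx'.2.1])
  have hF := cellScale_isSemialgebraicFunOn hre him' him hT hpos
  have hI : IntegrableOn (fun w : Fin 2 → ℝ => (if 1 < w 1 then (1 : ℝ) else -1) * z.im /
      (2 * ((1 - w 0 * z.re) ^ 2 + (w 0 * z.im) ^ 2) * w 1)) (Φ '' C.domain) := by
    rw [integrableOn_image_iff_integrableOn_abs_det_fderiv_smul volume hmeas hderiv hinj]
    refine C.integrableOn.congr_fun (fun x hx => ?_) hmeas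
    rw [hjac x hx, smul_eq_mul, mul_comm]
  refine ⟨⟨⟨Φ '' C.domain, _, hT, hF, hI⟩, himage, fun _ _ => rfl⟩, ?_⟩
  -- EVERY `[G-domain, sgn(v − 1)·b/(2 Q v)]` is one change-of-variables move away from `C`
  intro G hG hGi
  refine KZ.changeOfVariablesRel_subset_relations
    ⟨2, C, G, Φ, Φ', hΦsa, hderiv, hinj, hG.trans himage.symm, fun x hx => ?_, rfl⟩
  have hx' : Φ x ∈ G.domain := by
    rw [hG, ← himage]
    exact mem_image_of_mem Φ hx
  rw [hjac x hx, hGi hx']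

end Summit.KontsevichZagierPeriods.HyperbolicBloch.OffTetraSectorKernel

end
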